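import Summits.QuantumFields.BalabanUV.Beta.GAN24.ContactLambdaEntryBound
import Summits.QuantumFields.BalabanUV.Beta.GAN24.SymContactLambdaCellBound
import Summits.QuantumFields.BalabanUV.Beta.GAN24.SymContactLambdaCellFactorised

/-!
# `BalabanUV.Beta.GAN24.SymContactLambdaEntryBound` — binder row G-an2-4 ∕ (CONV-C), TRANSFER-III, the (III′) S-slot (b) of the END, born-Λ contact letter `hCg` (road-P2 M.104's
# 3rd hypothesis), TABLE HALF («mksym lane»), PART 8 — THE SOCKET: **THE ENTRY BOUND OF THE Λ CONTACT DIFFERENCE `push₃ T T T SΛ − push₃ B B B SΛ` AT an1's (0.4)-SYMMETRISED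
# CONSTRAINT HESSIAN `SΛ = SLam Lc c (symHessFFAt ρ Lc)` FROM LETTERS** (generic `d`; GENERIC legs `T B`, gauge `λ` with its staircase, coefficients `c`) — the decl-by-decl twin of
# leaf-02 g49's PART 3 `ContactLambdaEntryBound` with `hessFFAt ↦ symHessFFAt`, `linAvgAt ↦ symLinAvgAt`, `linCountAt ↦ symLinCountAt`, `Cnt ↦ (2Lc)^{d+1}·((d+1)·((d+1)!·(Lc^{d+1}·ℓ)))`,
# `(2Lc^{d+1})⁻¹ ↦ (2·((d+1)!·Lc^{d+1}))⁻¹`, over MY PARTs 2 ∕ 4 ∕ 7 (`SymContactFaceJumpCommutator`, `SymContactLambdaCellBound`, `SymContactLambdaCellFactorised`) and the table-free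
# (E) letters (`ContactGaugeStaircaseLocal`, `ContactLambdaCellBound.abs_sum_tsum_mul_le_of_env3`, `card_nearBox`, `mul_sum_ite`) BY NAME
# (G-an2-4 CRUX TEAM (2), leaf prover `b2b-balaban-gan24-formalise-leaf-01`, gen 90)

WHAT IS PROVED (generic `d`, `1 ≤ Lc`, box root; [folklore]): §1 `sum_abs_symLinCountAt_le_cnt`; §2 **`abs_sum_tsum_mixed_le`**; §3 **`abs_sum_tsum_dz_le`**; §4 **`abs_contact_entry_le`**
`|push₃ T T T (SLam Lc c symH_ρ) κ′u′ x′z′ (inl α)(inl β) − push₃ B B B (SLam Lc c symH_ρ) κ′u′ x′z′ (inl α)(inl β)|`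
`≤ (2·((d+1)!·Lc^{d+1}))⁻¹·((d+1)·T_b·(E₀²·Cnt_sym))·(2·K_B·(4α_g + 2α_g·Lc·n) + (8α_g² + 12α_g²·Lc·n))·((Lc^n)^{d+1}·Zl(κ∕(4(d+1))))·e^{−(κ∕12)(‖x′−u′‖∞ + ‖z′−u′‖∞)}` — the shape of the
(E) socket VERBATIM, so leaf-02's PART 4 count re-runs at (III′) with the conjugated legs (the comb twins `CombBornLambdaContact*`).
NOT HERE: the letters at `d = 3` and the unit count → `hCg` (the comb twins).

NOT IN PRINT; OUR BOOKKEEPING ([folklore]; 0 `def`, 0 cited fact, 0 `def … : Prop`, 0 sorry).  HONEST FRAMING (cell contract, verbatim): «discharging `BetaPertH` makes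
Bałaban's UV stability UNCONDITIONAL — a real constructive-QFT result; it is NOT the continuum limit and NOT the Clay problem.»  HONEST DEPENDENCY (verbatim): «continuum YM
on T⁴ ⇐ BetaPertH ∧ nine spine estimates (0/9 proved); BetaPertH ⇐ (D1) ∧ (D4) ∧ CAP+tail; G-an2-4 gates asym, D1 and NE2/3/4.»  Discharges NO letter of M.104 by itself;
NEVER «G-an2-4 closed» as (CONV-C); NOT D1, NOT `BetaPertH`, NOT continuum, NOT Clay.  2026-08-28; no existing file touched.
-/

noncomputable section

open Finset
open scoped BigOperators
open Literature.MathematicalPhysics.QuantumFieldTheory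
open Literature.MathematicalPhysics.QuantumFieldTheory.LatticeForm (quo)
open Literature.MathematicalPhysics.QuantumFieldTheory.Balaban1983to89
open Literature.MathematicalPhysics.QuantumFieldTheory.Balaban1983to89.Beta
open B4ContourShift (supNorm supNorm_nonneg)
open B12Sec2to5 (l1 l1_nonneg)
open ExpKernelCalculus (Zl Zl_nonneg)
open AffineAveraging (Form0 Form1 Site box toSite unitVec dz)
open AveragingContours (blk)
open AveragingHessianKernels (ell)
open Summit.QuantumFields.BalabanUV.Beta.SymmetrisedAxialPotential (symLinAvgAt)
open Summit.QuantumFields.BalabanUV.Beta.SymAveragingHessianCounts (symHessFFAt symLinCountAt)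
open InterLevelTransport (SLam)
open KernelWard (divV)
open Summit.QuantumFields.BalabanUV.Beta.LinearGaugeVH (nearBox mem_nearBox)
open Summit.QuantumFields.BalabanUV.Beta.GAN24.Push3 (push₃)
open Summit.QuantumFields.BalabanUV.Beta.GAN24.Push3LegTelescope (abs_le_of_env' summable_of_env')
open Summit.QuantumFields.BalabanUV.Beta.GAN24.Push3BorderGaugeSlotCells (card_nearBox)
open Summit.QuantumFields.BalabanUV.Beta.GAN24.SymContactFaceJumpCommutator (commutator_eq_sum sum_abs_symLinCountAt_le)
open Summit.QuantumFields.BalabanUV.Beta.GAN24.SymContactLambdaCellFactorised (contact_lambda_eq_factorised)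
open Summit.QuantumFields.BalabanUV.Beta.GAN24.SymContactLambdaCellBound (abs_commutator_le_of_staircase_of_env abs_commutator_dz_le_of_staircase_of_env)
open Summit.QuantumFields.BalabanUV.Beta.GAN24.ContactLambdaCellBound (abs_sum_tsum_mul_le_of_env3)
open Summit.QuantumFields.BalabanUV.Beta.GAN24.ContactLambdaEntryBound (mul_sum_ite)
open Summit.QuantumFields.BalabanUV.Beta.GAN24.ContactGaugeStaircaseLocal (env_label_le corner_le_of_mem_nearBox abs_weight_finest_le_env abs_dz_finest_le_env
  sum_abs_jump_le_env)

namespace Summit.QuantumFields.BalabanUV.Beta.GAN24.SymContactLambdaEntryBound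

variable {d : ℕ} {Lc : ℕ} {rr : Fin (d + 1) → ℕ}

/-! ## §1 The count constant and a scalar into the face letter -/

/-- [folklore] **THE COUNT CONSTANT** (leaf-01's `sum_abs_symLinCountAt_le` × `card_nearBox`): `Σ_{x ∈ nearBox Lc y} Σ_α |symLinCountAt ρ Lc μ y (α,x)| ≤ (2Lc)^{d+1}·((d+1)·((d+1)!·(Lc^{d+1}·ell (d+1) Lc)))`. -/
theorem sum_abs_symLinCountAt_le_cnt (hLc : 1 ≤ Lc) (hrr : rr ∈ box (d + 1) Lc) (μ : Fin (d + 1)) (y : Site (d + 1)) :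
    ∑ x ∈ nearBox Lc y, ∑ α, |(symLinCountAt (toSite rr) Lc μ y (α, x) : ℝ)|
      ≤ ((2 * Lc : ℕ) : ℝ) ^ (d + 1) * (((d + 1 : ℕ) : ℝ) * ((((d + 1).factorial : ℕ) : ℝ) * ((Lc : ℝ) ^ (d + 1) * (ell (d + 1) Lc : ℝ)))) := by
  have h := sum_abs_symLinCountAt_le hLc hrr μ y
  rw [card_nearBox] at h
  exact_mod_cast h

/-! ## §2 The mixed cell -/

section Mixed

variable {n : ℕ} {κ αg KB Tb : ℝ} {Gs : ℕ → Site (d + 1) → ℝ} {ψ : Site (d + 1) → ℝ} {R : Form1 (d + 1) ℝ}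
  {b : Fin (d + 1) → Site (d + 1) → ℝ} {xg xl u' : Site (d + 1)}

/-- NOT IN PRINT; OUR BOOKKEEPING ([folklore]; BORNSEC-PLAN v1.1 §0 (c) for ONE mixed cell, every input a letter).  **THE MIXED CELL**: brackets under the tent letter at
blocking `Lc^n` and label `u′`, a gauge staircase `ψ = Σ_{s<n+1} G s ∘ blk (Lc^s)` with localised geometric pieces (source label `x_g`), a leg under a block envelope (label `x_l`):
`|Σ_μ Σ'_y b μ y·[𝒬^ρ_{Lc,sym}, ψ̄]R (μ,y)| ≤ (d+1)·T_b·(E₀²·K_B·Cnt)·(4α_g + 2·α_g·Lc·n)·((Lc^n)^{d+1}·Zl(κ∕(4(d+1))))·e^{−(κ∕12)(‖x_g − u′‖∞ + ‖x_l − u′‖∞)}` and every `y`-family is summable. -/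
theorem abs_sum_tsum_mixed_le (hLc : 1 ≤ Lc) (hrr : rr ∈ box (d + 1) Lc) (hκ : 0 < κ) (hαg : 0 ≤ αg) (hKB : 0 ≤ KB) (hTb : 0 ≤ Tb)
    (hψ : ∀ u, ψ u = ∑ s ∈ Finset.range (n + 1), Gs s (blk (Lc ^ s) u))
    (hG : ∀ s, s ≤ n → ∀ u, |Gs s (blk (Lc ^ s) u)| ≤ αg * (Lc : ℝ) ^ s * Real.exp (-(κ * supNorm (quo (Lc ^ (n + 1)) u - xg))))
    (hR : ∀ a x, |R a x| ≤ KB * Real.exp (-(κ * supNorm (quo (Lc ^ (n + 1)) x - xl))))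
    (hb : ∀ μ y, |b μ y| ≤ Tb * Real.exp (-(κ * supNorm (quo (Lc ^ n) y - u')))) :
    (∀ μ, Summable fun y : Site (d + 1) => b μ y *
        (symLinAvgAt (toSite rr) (fun a x => (ψ x + ψ (x + unitVec a)) * R a x) Lc μ y
          - (ψ ((Lc : ℤ) • y + toSite rr) + ψ ((Lc : ℤ) • y + toSite rr + (Lc : ℤ) • unitVec μ)) * symLinAvgAt (toSite rr) R Lc μ y)) ∧
    |∑ μ, ∑' y : Site (d + 1), b μ y *
        (symLinAvgAt (toSite rr) (fun a x => (ψ x + ψ (x + unitVec a)) * R a x) Lc μ y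
          - (ψ ((Lc : ℤ) • y + toSite rr) + ψ ((Lc : ℤ) • y + toSite rr + (Lc : ℤ) • unitVec μ)) * symLinAvgAt (toSite rr) R Lc μ y)|
      ≤ ((d : ℝ) + 1) * Tb * (Real.exp (2 * ((d : ℝ) + 1) * κ) ^ 2 * KB *
            (((2 * Lc : ℕ) : ℝ) ^ (d + 1) * (((d + 1 : ℕ) : ℝ) * ((((d + 1).factorial : ℕ) : ℝ) * ((Lc : ℝ) ^ (d + 1) * (ell (d + 1) Lc : ℝ))))))
          * (4 * αg + 2 * αg * Lc * n) * ((((Lc ^ n : ℕ) : ℝ)) ^ (d + 1) * Zl (d + 1) (κ / (4 * ((d : ℝ) + 1)))) *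
          Real.exp (-(κ / 12) * (supNorm (xg - u') + supNorm (xl - u'))) := by
  set E₀ : ℝ := Real.exp (2 * ((d : ℝ) + 1) * κ) with hE₀
  set Cnt : ℝ := ((2 * Lc : ℕ) : ℝ) ^ (d + 1) * (((d + 1 : ℕ) : ℝ) * ((((d + 1).factorial : ℕ) : ℝ) * ((Lc : ℝ) ^ (d + 1) * (ell (d + 1) Lc : ℝ)))) with hCnt
  have hE₀0 : 0 ≤ E₀ := (Real.exp_pos _).le
  have hLn : 1 ≤ Lc ^ n := Nat.one_le_pow _ _ hLc
  -- the commutator letter of PART 1 §3 with PART 2's localised gauge letters and the leg envelope moved to the bond's label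
  have hc : ∀ μ y, |symLinAvgAt (toSite rr) (fun a x => (ψ x + ψ (x + unitVec a)) * R a x) Lc μ y
        - (ψ ((Lc : ℤ) • y + toSite rr) + ψ ((Lc : ℤ) • y + toSite rr + (Lc : ℤ) • unitVec μ)) * symLinAvgAt (toSite rr) R Lc μ y|
      ≤ (4 * αg + ∑ s ∈ Finset.range n, (if (Lc : ℤ) ^ s ∣ y μ + 1 then 2 * ((fun m => αg * (Lc : ℝ) ^ m) (s + 1)) else 0)) *
        ((E₀ ^ 2 * KB * Cnt) * Real.exp (-(κ * supNorm (quo (Lc ^ n) y - xg))) * Real.exp (-(κ * supNorm (quo (Lc ^ n) y - xl)))) := by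
    intro μ y
    have hW := fun a x (hx : x ∈ nearBox Lc y) => abs_weight_finest_le_env hLc hκ.le hαg hG hrr μ y a hx
    have hJ := sum_abs_jump_le_env hLc hκ.le hαg hG μ y
    have hB : ∀ a, ∀ x ∈ nearBox Lc y, |R a x| ≤ KB * (E₀ * Real.exp (-(κ * supNorm (quo (Lc ^ n) y - xl)))) := fun a x hx =>
      (hR a x).trans (mul_le_mul_of_nonneg_left (env_label_le hLc hκ.le n xl (corner_le_of_mem_nearBox hx)) hKB)
    have h := abs_commutator_le_of_staircase_of_env hLc hrr Gs n hψ R μ y (W₀ := 4 * αg)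
      (F := ∑ s ∈ Finset.range n, (if (Lc : ℤ) ^ s ∣ y μ + 1 then 2 * (αg * (Lc : ℝ) ^ (s + 1)) else 0))
      (E := E₀ * Real.exp (-(κ * supNorm (quo (Lc ^ n) y - xg)))) (M := KB * (E₀ * Real.exp (-(κ * supNorm (quo (Lc ^ n) y - xl)))))
      (by positivity) (by positivity) (by positivity) hW hJ hB (sum_abs_symLinCountAt_le_cnt hLc hrr μ y)
    refine h.trans (le_of_eq ?_)
    simp only []
    ring
  have ha : ∀ s, s < n → 0 ≤ (fun m => αg * (Lc : ℝ) ^ m) (s + 1) ∧ (fun m => αg * (Lc : ℝ) ^ m) (s + 1) ≤ αg * (Lc : ℝ) ^ (s + 1) :=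
    fun s _ => ⟨by positivity, le_rfl⟩
  exact abs_sum_tsum_mul_le_of_env3 (d := d) (Lc := Lc) (M := Lc ^ n) (n := n) hLc hLn (fun s hs => pow_dvd_pow Lc hs.le) hκ
    (a := fun m => αg * (Lc : ℝ) ^ m) ha (b := b)
    (c := fun μ y => symLinAvgAt (toSite rr) (fun a x => (ψ x + ψ (x + unitVec a)) * R a x) Lc μ y
          - (ψ ((Lc : ℤ) • y + toSite rr) + ψ ((Lc : ℤ) • y + toSite rr + (Lc : ℤ) • unitVec μ)) * symLinAvgAt (toSite rr) R Lc μ y)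
    hTb (by positivity : 0 ≤ E₀ ^ 2 * KB * Cnt) (by positivity : (0 : ℝ) ≤ 4 * αg) u' xg xl hb hc

end Mixed

/-! ## §3 The ΔΔ cell -/

section DeltaDelta

variable {n : ℕ} {κ αg Tb : ℝ} {Ga Gb : ℕ → Site (d + 1) → ℝ} {ψa ψb : Site (d + 1) → ℝ}
  {b : Fin (d + 1) → Site (d + 1) → ℝ} {xg xl u' : Site (d + 1)}

/-- NOT IN PRINT; OUR BOOKKEEPING ([folklore]; BORNSEC-PLAN v1.1 §0′ for ONE ΔΔ cell).  **THE ΔΔ CELL**: two gauge staircases with localised geometric pieces of the same letter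
`α_g` (sources `x_g`, `x_l`), brackets under the tent letter:
`|Σ_μ Σ'_y b μ y·[𝒬^ρ_{Lc}, ψ̄_a](dz ψ_b)(μ,y)| ≤ (d+1)·T_b·(E₀²·Cnt)·(8α_g² + 2·(6α_g²)·Lc·n)·((Lc^n)^{d+1}·Zl)·e^{−(κ∕12)(‖x_g − u′‖∞ + ‖x_l − u′‖∞)}` and every `y`-family is summable. -/
theorem abs_sum_tsum_dz_le (hLc : 1 ≤ Lc) (hrr : rr ∈ box (d + 1) Lc) (hκ : 0 < κ) (hαg : 0 ≤ αg) (hTb : 0 ≤ Tb)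
    (hψa : ∀ u, ψa u = ∑ s ∈ Finset.range (n + 1), Ga s (blk (Lc ^ s) u))
    (hψb : ∀ u, ψb u = ∑ s ∈ Finset.range (n + 1), Gb s (blk (Lc ^ s) u))
    (hGa : ∀ s, s ≤ n → ∀ u, |Ga s (blk (Lc ^ s) u)| ≤ αg * (Lc : ℝ) ^ s * Real.exp (-(κ * supNorm (quo (Lc ^ (n + 1)) u - xg))))
    (hGb : ∀ s, s ≤ n → ∀ u, |Gb s (blk (Lc ^ s) u)| ≤ αg * (Lc : ℝ) ^ s * Real.exp (-(κ * supNorm (quo (Lc ^ (n + 1)) u - xl))))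
    (hb : ∀ μ y, |b μ y| ≤ Tb * Real.exp (-(κ * supNorm (quo (Lc ^ n) y - u')))) :
    (∀ μ, Summable fun y : Site (d + 1) => b μ y *
        (symLinAvgAt (toSite rr) (fun a x => (ψa x + ψa (x + unitVec a)) * dz ψb a x) Lc μ y
          - (ψa ((Lc : ℤ) • y + toSite rr) + ψa ((Lc : ℤ) • y + toSite rr + (Lc : ℤ) • unitVec μ)) * symLinAvgAt (toSite rr) (dz ψb) Lc μ y)) ∧
    |∑ μ, ∑' y : Site (d + 1), b μ y *
        (symLinAvgAt (toSite rr) (fun a x => (ψa x + ψa (x + unitVec a)) * dz ψb a x) Lc μ y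
          - (ψa ((Lc : ℤ) • y + toSite rr) + ψa ((Lc : ℤ) • y + toSite rr + (Lc : ℤ) • unitVec μ)) * symLinAvgAt (toSite rr) (dz ψb) Lc μ y)|
      ≤ ((d : ℝ) + 1) * Tb * (Real.exp (2 * ((d : ℝ) + 1) * κ) ^ 2 *
            (((2 * Lc : ℕ) : ℝ) ^ (d + 1) * (((d + 1 : ℕ) : ℝ) * ((((d + 1).factorial : ℕ) : ℝ) * ((Lc : ℝ) ^ (d + 1) * (ell (d + 1) Lc : ℝ))))))
          * (8 * αg ^ 2 + 2 * (6 * αg ^ 2) * Lc * n) * ((((Lc ^ n : ℕ) : ℝ)) ^ (d + 1) * Zl (d + 1) (κ / (4 * ((d : ℝ) + 1)))) *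
          Real.exp (-(κ / 12) * (supNorm (xg - u') + supNorm (xl - u'))) := by
  set E₀ : ℝ := Real.exp (2 * ((d : ℝ) + 1) * κ) with hE₀
  set Cnt : ℝ := ((2 * Lc : ℕ) : ℝ) ^ (d + 1) * (((d + 1 : ℕ) : ℝ) * ((((d + 1).factorial : ℕ) : ℝ) * ((Lc : ℝ) ^ (d + 1) * (ell (d + 1) Lc : ℝ)))) with hCnt
  have hE₀0 : 0 ≤ E₀ := (Real.exp_pos _).le
  have hLn : 1 ≤ Lc ^ n := Nat.one_le_pow _ _ hLc
  have hc : ∀ μ y, |symLinAvgAt (toSite rr) (fun a x => (ψa x + ψa (x + unitVec a)) * dz ψb a x) Lc μ y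
        - (ψa ((Lc : ℤ) • y + toSite rr) + ψa ((Lc : ℤ) • y + toSite rr + (Lc : ℤ) • unitVec μ)) * symLinAvgAt (toSite rr) (dz ψb) Lc μ y|
      ≤ (8 * αg ^ 2 + ∑ s ∈ Finset.range n, (if (Lc : ℤ) ^ s ∣ y μ + 1 then 2 * ((fun m => 6 * αg * (αg * (Lc : ℝ) ^ m)) (s + 1)) else 0)) *
        ((E₀ ^ 2 * Cnt) * Real.exp (-(κ * supNorm (quo (Lc ^ n) y - xg))) * Real.exp (-(κ * supNorm (quo (Lc ^ n) y - xl)))) := by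
    intro μ y
    classical
    have hWa := fun a x (hx : x ∈ nearBox Lc y) => abs_weight_finest_le_env hLc hκ.le hαg hGa hrr μ y a hx
    have hgb := fun a x (hx : x ∈ nearBox Lc y) => abs_dz_finest_le_env hLc hκ.le hαg hGb y a hx
    have hJa := sum_abs_jump_le_env hLc hκ.le hαg hGa μ y
    have hJb := sum_abs_jump_le_env hLc hκ.le hαg hGb μ y
    have h := abs_commutator_dz_le_of_staircase_of_env hLc hrr Ga Gb n hψa hψb μ y (Wa := 4 * αg) (gb := 2 * αg)
      (F := ∑ s ∈ Finset.range n, (if (Lc : ℤ) ^ s ∣ y μ + 1 then 2 * (αg * (Lc : ℝ) ^ (s + 1)) else 0))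
      (Ea := E₀ * Real.exp (-(κ * supNorm (quo (Lc ^ n) y - xg)))) (Eb := E₀ * Real.exp (-(κ * supNorm (quo (Lc ^ n) y - xl))))
      (by positivity) (by positivity) (by positivity) (by positivity) hWa hgb hJa hJb (sum_abs_symLinCountAt_le_cnt hLc hrr μ y)
    refine h.trans (le_of_eq ?_)
    rw [show (4 * αg + 2 * αg) * ∑ s ∈ Finset.range n, (if (Lc : ℤ) ^ s ∣ y μ + 1 then 2 * (αg * (Lc : ℝ) ^ (s + 1)) else 0)
      = ∑ s ∈ Finset.range n, (if (Lc : ℤ) ^ s ∣ y μ + 1 then 2 * ((fun m => 6 * αg * (αg * (Lc : ℝ) ^ m)) (s + 1)) else 0) by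
        rw [show (4 * αg + 2 * αg) = 6 * αg by ring, mul_sum_ite]]
    ring
  have ha : ∀ s, s < n → 0 ≤ (fun m => 6 * αg * (αg * (Lc : ℝ) ^ m)) (s + 1) ∧
      (fun m => 6 * αg * (αg * (Lc : ℝ) ^ m)) (s + 1) ≤ (6 * αg ^ 2) * (Lc : ℝ) ^ (s + 1) :=
    fun s _ => ⟨by positivity, le_of_eq (by simp only []; ring)⟩
  exact abs_sum_tsum_mul_le_of_env3 (d := d) (Lc := Lc) (M := Lc ^ n) (n := n) hLc hLn (fun s hs => pow_dvd_pow Lc hs.le) hκ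
    (a := fun m => 6 * αg * (αg * (Lc : ℝ) ^ m)) ha (b := b)
    (c := fun μ y => symLinAvgAt (toSite rr) (fun a x => (ψa x + ψa (x + unitVec a)) * dz ψb a x) Lc μ y
          - (ψa ((Lc : ℤ) • y + toSite rr) + ψa ((Lc : ℤ) • y + toSite rr + (Lc : ℤ) • unitVec μ)) * symLinAvgAt (toSite rr) (dz ψb) Lc μ y)
    hTb (by positivity : 0 ≤ E₀ ^ 2 * Cnt) (by positivity : (0 : ℝ) ≤ 8 * αg ^ 2) u' xg xl hb hc

end DeltaDelta


/-! ## §4 The entry bound of the Λ contact difference -/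

section Entry

variable {n : ℕ} {κ αg KB CT Clam Tb Cc δc : ℝ}
  {T B : Fin (d + 1) → (Fin (d + 1) → ℤ) → Fin (d + 1) → (Fin (d + 1) → ℤ) → ℝ}
  {lam : Fin (d + 1) → (Fin (d + 1) → ℤ) → (Fin (d + 1) → ℤ) → ℝ}
  {G : Fin (d + 1) → (Fin (d + 1) → ℤ) → ℕ → Site (d + 1) → ℝ}
  {c : Fin (d + 1) → (Fin (d + 1) → ℤ) → Fin (d + 1) → (Fin (d + 1) → ℤ) → ℝ}

/-- NOT IN PRINT; OUR BOOKKEEPING ([folklore]; BORNSEC-PLAN v1.1 §0 (c) + §0′ per lineage, every analytic input a LETTER).  **THE ENTRY BOUND OF THE Λ CONTACT DIFFERENCE.**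
Legs `T` (dressed: bounded with summable fine slices) and `B` (undressed: block envelope `K_B·e^{−κ‖quo (Lc^{n+1}) u − z‖∞}`) with `T − B = dz λ`, the bond gauge functions
`λ_{μ₀z₀}` staircases of depth `n+1` with localised geometric pieces (`α_g·Lc^s`, source label `z₀`), a coefficient family `c` under its decay ∕ transversality letters and the
BRACKET (tent) letter `|⟨T(κ′u′;·), c(μ,y;·)⟩| ≤ T_b·e^{−κ‖quo (Lc^n) y − u′‖∞}`.  THEN for all `κ′ u′ x′ z′ α β`
`|push₃ T T T (SLam Lc c H_ρ) κ′u′ x′z′ (inl α)(inl β) − push₃ B B B (SLam Lc c H_ρ) κ′u′ x′z′ (inl α)(inl β)|`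
`≤ (2·((d+1)!·Lc^{d+1}))⁻¹·((d+1)·T_b·(E₀²·Cnt))·(2·K_B·(4α_g + 2α_g·Lc·n) + (8α_g² + 12α_g²·Lc·n))·((Lc^n)^{d+1}·Zl(κ∕(4(d+1))))·e^{−(κ∕12)(‖x′−u′‖∞ + ‖z′−u′‖∞)}`
— the socket `contact_lambda_eq_factorised`, the split `T = B + dz λ` of the first cell's leg (`commutator_eq_sum` is linear in the 1-form), §2 twice and §3 once. -/
theorem abs_contact_entry_le (hLc : 1 ≤ Lc) (hrr : rr ∈ box (d + 1) Lc) (hκ : 0 < κ) (hαg : 0 ≤ αg) (hKB : 0 ≤ KB) (hTb : 0 ≤ Tb)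
    (hc : ∀ μ y κ u, |c μ y κ u| ≤ Cc * Real.exp (-δc * l1 ((Lc : ℤ) • y - u))) (hδc : 0 < δc) (hCc : 0 ≤ Cc)
    (hdiv : ∀ u, divV (SLam Lc c (fun μ y => symHessFFAt (toSite rr) Lc μ y)) u = 0)
    (hT : ∀ μ z κ u, |T μ z κ u| ≤ CT) (hTs : ∀ μ z κ, Summable fun u => T μ z κ u)
    (hB : ∀ μ z l u, |B μ z l u| ≤ KB * Real.exp (-(κ * supNorm (quo (Lc ^ (n + 1)) u - z))))
    (hTB : T - B = fun μ z κ u => dz (lam μ z) κ u) (hlam : ∀ μ z u, |lam μ z u| ≤ Clam)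
    (hψ : ∀ μ₀ z₀ u, lam μ₀ z₀ u = ∑ s ∈ Finset.range (n + 1), G μ₀ z₀ s (blk (Lc ^ s) u))
    (hG : ∀ μ₀ z₀ s, s ≤ n → ∀ u, |G μ₀ z₀ s (blk (Lc ^ s) u)| ≤ αg * (Lc : ℝ) ^ s * Real.exp (-(κ * supNorm (quo (Lc ^ (n + 1)) u - z₀))))
    (hbr : ∀ (κ' : Fin (d + 1)) (u' : Site (d + 1)) μ y,
      |∑' u, ∑ κ, T κ' u' κ u * c μ y κ u| ≤ Tb * Real.exp (-(κ * supNorm (quo (Lc ^ n) y - u'))))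
    (κ' : Fin (d + 1)) (u' x' z' : Site (d + 1)) (α β : Fin (d + 1)) :
    |push₃ T T T (SLam Lc c (fun μ y => symHessFFAt (toSite rr) Lc μ y)) κ' u' x' z' (Sum.inl α) (Sum.inl β)
        - push₃ B B B (SLam Lc c (fun μ y => symHessFFAt (toSite rr) Lc μ y)) κ' u' x' z' (Sum.inl α) (Sum.inl β)|
      ≤ (2 * ((((d + 1).factorial : ℕ) : ℝ) * (Lc : ℝ) ^ (d + 1)))⁻¹ *
          ((((d : ℝ) + 1) * Tb * (Real.exp (2 * ((d : ℝ) + 1) * κ) ^ 2 *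
              (((2 * Lc : ℕ) : ℝ) ^ (d + 1) * (((d + 1 : ℕ) : ℝ) * ((((d + 1).factorial : ℕ) : ℝ) * ((Lc : ℝ) ^ (d + 1) * (ell (d + 1) Lc : ℝ)))))))
            * (2 * KB * (4 * αg + 2 * αg * Lc * n) + (8 * αg ^ 2 + 2 * (6 * αg ^ 2) * Lc * n))
            * ((((Lc ^ n : ℕ) : ℝ)) ^ (d + 1) * Zl (d + 1) (κ / (4 * ((d : ℝ) + 1))))
            * Real.exp (-(κ / 12) * (supNorm (x' - u') + supNorm (z' - u')))) := by
  -- the leg class of `B` and the socket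
  have hLn1 : 1 ≤ Lc ^ (n + 1) := Nat.one_le_pow _ _ hLc
  have hBb : ∀ μ z l u, |B μ z l u| ≤ KB := abs_le_of_env' hκ.le hB
  have hBs : ∀ μ z l, Summable fun u => B μ z l u := summable_of_env' hLn1 hκ hB
  rw [contact_lambda_eq_factorised hLc hrr hc hδc hCc hdiv hT hTs hBb hBs hT hTs hBb hBs hT hBb hTB hTB hTB hlam κ' u' x' z' α β]
  -- the split of the first cell's leg `T β z′ = B β z′ + dz (λ β z′)`
  have eT : ∀ b z, T β z' b z = B β z' b z + dz (lam β z') b z := fun b z => by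
    have h := congrFun (congrFun (congrFun (congrFun hTB β) z') b) z
    simp only [Pi.sub_apply] at h
    linarith
  have hsplit : ∀ μ y,
      symLinAvgAt (toSite rr) (fun b z => (lam α x' z + lam α x' (z + unitVec b)) * T β z' b z) Lc μ y
          - (lam α x' ((Lc : ℤ) • y + toSite rr) + lam α x' ((Lc : ℤ) • y + toSite rr + (Lc : ℤ) • unitVec μ)) * symLinAvgAt (toSite rr) (T β z') Lc μ y
        = (symLinAvgAt (toSite rr) (fun b z => (lam α x' z + lam α x' (z + unitVec b)) * B β z' b z) Lc μ y
            - (lam α x' ((Lc : ℤ) • y + toSite rr) + lam α x' ((Lc : ℤ) • y + toSite rr + (Lc : ℤ) • unitVec μ)) * symLinAvgAt (toSite rr) (B β z') Lc μ y)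
          + (symLinAvgAt (toSite rr) (fun b z => (lam α x' z + lam α x' (z + unitVec b)) * dz (lam β z') b z) Lc μ y
            - (lam α x' ((Lc : ℤ) • y + toSite rr) + lam α x' ((Lc : ℤ) • y + toSite rr + (Lc : ℤ) • unitVec μ))
              * symLinAvgAt (toSite rr) (dz (lam β z')) Lc μ y) := by
    intro μ y
    rw [commutator_eq_sum hrr, commutator_eq_sum hrr, commutator_eq_sum hrr (B := dz (lam β z')), ← Finset.sum_add_distrib]
    refine Finset.sum_congr rfl fun x _ => ?_
    rw [← Finset.sum_add_distrib]
    refine Finset.sum_congr rfl fun a _ => ?_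
    rw [eT a x]; ring
  -- the three cells
  obtain ⟨hs1, hb1⟩ := abs_sum_tsum_mixed_le (xg := x') (xl := z') hLc hrr hκ hαg hKB hTb (hψ α x') (hG α x') (fun a x => hB β z' a x) (hbr κ' u')
  obtain ⟨hs2, hb2⟩ := abs_sum_tsum_dz_le (xg := x') (xl := z') hLc hrr hκ hαg hTb (hψ α x') (hψ β z') (hG α x') (hG β z') (hbr κ' u')
  obtain ⟨hs3, hb3⟩ := abs_sum_tsum_mixed_le (xg := z') (xl := x') hLc hrr hκ hαg hKB hTb (hψ β z') (hG β z') (fun a x => hB α x' a x) (hbr κ' u')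
  rw [add_comm (supNorm (z' - u')) (supNorm (x' - u'))] at hb3
  -- the first cell's (μ,y)-sum splits
  have hL : (∑ μ, ∑' y : Site (d + 1), (∑' u, ∑ κ, T κ' u' κ u * c μ y κ u) *
        (symLinAvgAt (toSite rr) (fun b z => (lam α x' z + lam α x' (z + unitVec b)) * T β z' b z) Lc μ y
          - (lam α x' ((Lc : ℤ) • y + toSite rr) + lam α x' ((Lc : ℤ) • y + toSite rr + (Lc : ℤ) • unitVec μ)) * symLinAvgAt (toSite rr) (T β z') Lc μ y))
      = (∑ μ, ∑' y : Site (d + 1), (∑' u, ∑ κ, T κ' u' κ u * c μ y κ u) *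
          (symLinAvgAt (toSite rr) (fun b z => (lam α x' z + lam α x' (z + unitVec b)) * B β z' b z) Lc μ y
            - (lam α x' ((Lc : ℤ) • y + toSite rr) + lam α x' ((Lc : ℤ) • y + toSite rr + (Lc : ℤ) • unitVec μ)) * symLinAvgAt (toSite rr) (B β z') Lc μ y))
        + (∑ μ, ∑' y : Site (d + 1), (∑' u, ∑ κ, T κ' u' κ u * c μ y κ u) *
          (symLinAvgAt (toSite rr) (fun b z => (lam α x' z + lam α x' (z + unitVec b)) * dz (lam β z') b z) Lc μ y
            - (lam α x' ((Lc : ℤ) • y + toSite rr) + lam α x' ((Lc : ℤ) • y + toSite rr + (Lc : ℤ) • unitVec μ))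
              * symLinAvgAt (toSite rr) (dz (lam β z')) Lc μ y)) := by
    rw [← Finset.sum_add_distrib]
    refine Finset.sum_congr rfl fun μ _ => ?_
    rw [← (hs1 μ).tsum_add (hs2 μ)]
    refine tsum_congr fun y => ?_
    rw [hsplit μ y]; ring
  rw [hL]
  -- combine: `|−w(A₁ + A₂) + w A₃| ≤ w(|A₃| + |A₁| + |A₂|)`
  have hw : 0 ≤ (2 * ((((d + 1).factorial : ℕ) : ℝ) * (Lc : ℝ) ^ (d + 1)))⁻¹ := by positivity
  have e : ∀ A1 A2 A3 : ℝ, -(2 * ((((d + 1).factorial : ℕ) : ℝ) * (Lc : ℝ) ^ (d + 1)))⁻¹ * (A1 + A2) - -(2 * ((((d + 1).factorial : ℕ) : ℝ) * (Lc : ℝ) ^ (d + 1)))⁻¹ * A3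
      = (2 * ((((d + 1).factorial : ℕ) : ℝ) * (Lc : ℝ) ^ (d + 1)))⁻¹ * (A3 - (A1 + A2)) := fun _ _ _ => by ring
  rw [e, abs_mul, abs_of_nonneg hw]
  refine (mul_le_mul_of_nonneg_left ((abs_sub _ _).trans (add_le_add hb3 ((abs_add_le _ _).trans (add_le_add hb1 hb2)))) hw).trans
    (le_of_eq ?_)
  ring

end Entry

end Summit.QuantumFields.BalabanUV.Beta.GAN24.SymContactLambdaEntryBound

end
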